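import Literature.AlgebraicGeometry.AbelianVarieties.MumfordSheafLinearisation
import Literature.AlgebraicGeometry.RelativeSpec.EquivariantDescentRestrict
import Literature.AlgebraicGeometry.Motives.AbelianVarietyDualQuotientAction
import Literature.AlgebraicGeometry.RelativeSpec.GeometricQuotientFreeFlat
import Literature.AlgebraicGeometry.Modules.PullbackQuasicoherent
import HarnessLib

/-!
# The normalised Poincaré sheaf of `(A, Θ)` over `ℂ`: `(1 × φ_Θ)^*𝒫 ≅ Λ(Θ)` and `𝒫|_{{0} × Â} ≅ 𝒪_Â`

Layer `Literature/AlgebraicGeometry/AbelianVarieties`, namespace `Literature.AlgebraicGeometry.AbelianVarieties`. THEOREMS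
ONLY; no named fact, no instance, no notation. Cell `hodgecm-mathlib` (D-0151), M1PRIME-DAG rung 0, J0a junction, leaf
(J0a-3a/b) (B-p07 lineage; inputs: B-p16's (J0a-1) `Motives/AbelianVarietyDualQuotientAction` — the free affine geometric
quotients `1 × φ_Θ`, `φ_Θ` by `K(Θ)` and descent along them — and (J0a-2) `AbelianVarieties/MumfordSheafLinearisation`).
For a complex abelian variety `A` and an ample divisor `Θ`, with `Â := A/K(Θ)` (★ `dualOf`) and `φ_Θ` (★ `phiTheta`):
**there is a quasi-coherent line bundle `𝒫` on `A × Â` with `(1 × φ_Θ)^*𝒫 ≅ Λ(𝒪(Θ)) = m^*𝒪(Θ) ⊗ p₁^*𝒪(Θ)⁻¹ ⊗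
p₂^*𝒪(Θ)⁻¹` and `𝒫|_{{0} × Â} ≅ 𝒪_Â`** — the fields `P`, `hasRank_one`, `rigid` of the tree's `AbelianSchemes.DualPair`
(★ D2) for `dualOf A Θ` (the bridge `(A.prod Â).X.left = (ofAbelianVariety A).prodLeft (ofAbelianVariety Â)` is `rfl`).
[MumfordAV1970] §8 pp. 78–80 (char `0`): «there is a sheaf `P` on `X × X̂` such that `(1 × φ_L)^*P ≅ Λ(L)` …
normalised by `P|_{{0}×X̂}` trivial»; [MilneAV2008] I §8 (p. 40), Prop. 8.13. Banked capital; HC_CM is proved only modulo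
the 7 printed citations until rung 0 closes.

Proof: Mumford's `K(Θ)`-linearisation `Φ` of `Λ(Θ)` normalised along `{0} × A` (`exists_equivariantStructure_mumfordSheaf_of_autHom_eq`
for B-p16's presentations `kThetaActionOver`/`kThetaBaseActionOver` of the actions) descends along the free quotient `1 × φ_Θ`
(`AbelianVariety.exists_descent_of_equivariantStructure`); restricting the descent datum along the equivariant slice
`{0} × A → {0} × Â` (the square `ι ≫ (1 × φ_Θ) = φ_Θ ≫ ι'`) and comparing with the trivial datum by uniqueness of descent
along `φ_Θ` (`ActionOver.exists_iso_pullback_descended_of_restrict`) gives `ι'^*𝒫 ≅ 𝒪_Â`.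

## References

* [MumfordAV1970] D. Mumford, *Abelian Varieties* (1970), §8 pp. 78–80.
* [MilneAV2008] J. S. Milne, *Abelian Varieties* (2008), I §8 (pp. 36–40), Prop. 8.13.
-/

noncomputable section

open CategoryTheory AlgebraicGeometry MonoidalCategory CartesianMonoidalCategory Opposite
open Literature.AlgebraicGeometry.Motives Literature.AlgebraicGeometry.Modules
open Literature.AlgebraicGeometry.RelativeSpec
open scoped MonObj

universe u

namespace Literature.AlgebraicGeometry.AbelianVarieties

variable (A : AbelianVariety ℂ) {Θ : CartierDivisor A.X.left} (hΘ : Θ.IsAmple)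

/-- **The slice square `ι_A ≫ (1 × φ_Θ) = φ_Θ ≫ ι_Â`** (`ι = (0, id)`). [cite: MumfordAV1970, §8 (pp. 78–80)] -/
theorem sliceZero_comp_oneProdPhiTheta :
    (sliceZero A A).left ≫ AbelianVariety.Hom.toSchemeHom (A.oneProdPhiTheta hΘ) =
      AbelianVariety.Hom.toSchemeHom (A.phiTheta Θ hΘ) ≫ (sliceZero A (A.dualOf Θ hΘ)).left := by
  -- name the two underlying `SchemeOver`-morphisms, so that all rewriting happens in `SchemeOver ℂ`
  obtain ⟨F, hF⟩ : ∃ F : A.X ⊗ A.X ⟶ A.X ⊗ (A.dualOf Θ hΘ).X, F = (A.oneProdPhiTheta hΘ).hom.hom.hom := ⟨_, rfl⟩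
  obtain ⟨φ, hφ⟩ : ∃ φ : A.X ⟶ (A.dualOf Θ hΘ).X, φ = (A.phiTheta Θ hΘ).hom.hom.hom := ⟨_, rfl⟩
  have h1 : F ≫ fst A.X (A.dualOf Θ hΘ).X = fst A.X A.X := by
    rw [hF]; exact AbelianVariety.oneProdPhiTheta_comp_fst A hΘ
  have h2 : F ≫ snd A.X (A.dualOf Θ hΘ).X = snd A.X A.X ≫ φ := by
    rw [hF, hφ]; exact AbelianVariety.oneProdPhiTheta_comp_snd A hΘ
  have hsq : sliceZero A A ≫ F = φ ≫ sliceZero A (A.dualOf Θ hΘ) := by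
    refine CartesianMonoidalCategory.hom_ext _ _ ?_ ?_
    · rw [Category.assoc, h1, sliceZero_fst, Category.assoc, sliceZero_fst, MonObj.comp_one]
    · rw [Category.assoc, h2, sliceZero_snd_assoc, Category.assoc, sliceZero_snd, Category.comp_id]
  have e1 : AbelianVariety.Hom.toSchemeHom (A.oneProdPhiTheta hΘ) = F.left := by rw [hF]
  have e2 : AbelianVariety.Hom.toSchemeHom (A.phiTheta Θ hΘ) = φ.left := by rw [hφ]
  rw [e1, e2]
  exact congrArg CommaMorphism.left hsq

/-- B-p16's `kThetaActionOver` acts by `1 × t_g` (whisker form). [cite: MilneAV2008, I §8 (p. 40)] -/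
theorem autHom_kThetaActionOver (g : A.KTheta Θ) :
    (A.kThetaActionOver hΘ).autHom g = (A.X ◁ A.translation ((A.KTheta Θ).subtype g)).left := by
  change ((A.kThetaActionOver hΘ).aut g).hom = _
  rw [AbelianVariety.kThetaActionOver_aut_hom, ← AbelianVariety.whiskerLeft_translation]
  rfl

/-- B-p16's `kThetaBaseActionOver` acts by `t_g`. [cite: MilneAV2008, I §8 (p. 40)] -/
theorem autHom_kThetaBaseActionOver (g : A.KTheta Θ) :
    (A.kThetaBaseActionOver hΘ).autHom g = (A.translation ((A.KTheta Θ).subtype g)).left := rfl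

/-- **The normalised Poincaré sheaf of `(A, Θ)`**: a quasi-coherent line bundle `𝒫` on `A × Â`, `Â = A/K(Θ)`, with
`(1 × φ_Θ)^*𝒫 ≅ Λ(𝒪(Θ))` (Mumford §8 / Milne Prop. 8.13) and `𝒫|_{{0} × Â} ≅ 𝒪_Â` (Milne I §8 (b)) — the fields
`P`/`hasRank_one`/`rigid` of a dual pair for `dualOf A Θ`. [cite: MumfordAV1970, §8 (pp. 78–80)] [cite: MilneAV2008, I §8 (p. 40) and Prop. 8.13] -/
theorem exists_poincareSheaf_normalised :
    ∃ (P : (A.prod (A.dualOf Θ hΘ)).X.left.Modules) (_ : P.IsQuasicoherent) (_ : HasRank P 1),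
      Nonempty ((Scheme.Modules.pullback (AbelianVariety.Hom.toSchemeHom (A.oneProdPhiTheta hΘ))).obj P ≅
          mumfordSheaf A Θ) ∧
        Nonempty ((Scheme.Modules.pullback (sliceZero A (A.dualOf Θ hΘ)).left).obj P ≅
          unitModule (A.dualOf Θ hΘ).X.left) := by
  -- the two presentations of the `K(Θ)`-actions (B-p16) and the normalised linearisation (J0a-2)
  obtain ⟨e, Φ, hΦ⟩ := exists_equivariantStructure_mumfordSheaf_of_autHom_eq A (A.KTheta Θ).subtype Θ
    (A.kThetaActionOver hΘ) (A.kThetaBaseActionOver hΘ) (autHom_kThetaActionOver A hΘ)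
    (autHom_kThetaBaseActionOver A hΘ) (fun g => g.2)
  -- descent along `1 × φ_Θ` (J0a-1)
  obtain ⟨P, hqc, hP1, eP, heP⟩ :=
    A.exists_descent_of_equivariantStructure hΘ (mumfordSheaf A Θ) Φ (hasRank_mumfordSheaf A Θ)
  refine ⟨P, hqc, hP1, ⟨eP⟩, ?_⟩
  -- rigidification: uniqueness of descent along the free quotient `φ_Θ`, restricted along the slice square
  haveI : Finite ↥(A.KTheta Θ) := A.finite_kTheta_subtype hΘ
  haveI : Fintype ↥(A.KTheta Θ) := Fintype.ofFinite _
  haveI := A.isAffineHom_phiTheta hΘ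
  haveI : Flat (AbelianVariety.Hom.toSchemeHom (A.phiTheta Θ hΘ)) :=
    (A.isGeometricQuotient_kThetaBaseActionOver hΘ).flat_of_free (A.kThetaBaseActionOver_free hΘ)
  haveI := (HasRank.isFiniteLocallyFree' (hasRank_mumfordSheaf A Θ)).isVectorBundle.1
  -- the descent datum of `𝒫` in the form of (T2)
  have hofPb : ∀ g : A.KTheta Θ, ((ActionOver.EquivariantStructure.ofPullback (A.kThetaActionOver hΘ) P).iso g).hom =
      ((Scheme.Modules.pullbackComp ((A.kThetaActionOver hΘ).aut g).hom
          (AbelianVariety.Hom.toSchemeHom (A.oneProdPhiTheta hΘ))).app P ≪≫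
        (Scheme.Modules.pullbackCongr ((A.kThetaActionOver hΘ).aut_comp g)).app P).hom := fun g => rfl
  have heP' : ∀ g : A.KTheta Θ,
      (Scheme.Modules.pullback ((A.kThetaActionOver hΘ).autHom g)).map eP.hom ≫ (Φ.iso g).hom =
        ((ActionOver.EquivariantStructure.ofPullback (A.kThetaActionOver hΘ) P).iso g).hom ≫ eP.hom := by
    intro g
    rw [hofPb g]
    exact heP g
  -- the slice trivialisation in the form of (T2): `e.symm : φ_Θ^* 𝒪_Â ≅ ι^* Λ`
  have he₂ : ∀ g : A.KTheta Θ,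
      (Scheme.Modules.pullback ((A.kThetaBaseActionOver hΘ).autHom g)).map e.symm.hom ≫
          ((Φ.restrict (A.kThetaBaseActionOver hΘ) (sliceZero A A).left
            (sliceZero_equivariant_of_autHom_eq A (A.KTheta Θ).subtype _ _ (autHom_kThetaActionOver A hΘ)
              (autHom_kThetaBaseActionOver A hΘ)) (isFiniteLocallyFree_mumfordSheaf A Θ)).iso g).hom =
        ((ActionOver.EquivariantStructure.ofPullback (A.kThetaBaseActionOver hΘ)
            (unitModule (A.dualOf Θ hΘ).X.left)).iso g).hom ≫ e.symm.hom := by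
    intro g
    rw [ActionOver.EquivariantStructure.restrict_iso_hom, Iso.symm_hom, ← cancel_mono e.hom, Category.assoc,
      Category.assoc, hΦ g, ← Functor.map_comp_assoc, e.inv_hom_id, CategoryTheory.Functor.map_id, Category.id_comp,
      Category.comp_id]
  have hqcι : ((Scheme.Modules.pullback (sliceZero A A).left).obj (mumfordSheaf A Θ)).IsQuasicoherent :=
    isQuasicoherent_pullback _ _
  obtain ⟨i, -⟩ := @ActionOver.exists_iso_pullback_descended_of_restrict _ _ _ _ _ _ _ _ (A.kThetaActionOver hΘ)
    (A.kThetaBaseActionOver hΘ) (sliceZero A A).left (sliceZero A (A.dualOf Θ hΘ)).left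
    (sliceZero_comp_oneProdPhiTheta A hΘ)
    (sliceZero_equivariant_of_autHom_eq A (A.KTheta Θ).subtype _ _ (autHom_kThetaActionOver A hΘ)
      (autHom_kThetaBaseActionOver A hΘ))
    _ (isFiniteLocallyFree_mumfordSheaf A Θ) Φ _ (HasRank.isFiniteLocallyFree' hP1) eP heP' _ _ _
    (A.isGeometricQuotient_kThetaBaseActionOver hΘ) (A.kThetaBaseActionOver_free hΘ) hqcι
    (unitModule (A.dualOf Θ hΘ).X.left) e.symm he₂
  exact ⟨i⟩

end Literature.AlgebraicGeometry.AbelianVarieties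

end
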